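import Mathlib.CategoryTheory.Localization.Predicate
import Literature.AlgebraicGeometry.Frobenioids.BirationalizationCategory
import HarnessLib

/-!
# Frobenioids I, Prop. 4.4 (i): the universal property of the birationalization `C → C^birat`

Mochizuki, *The geometry of Frobenioids I*, Kyushu J. Math. **62** (2008), Prop. 4.4 (i) p. 82
[cite: MochizukiFrdI2008, Prop. 4.4 (i) p.82]: `Hom^birat_C(A, B) := colim_{(A' → A) ∈ C^coa-pre_A}
Hom_C(A', B)`. The category `C^birat` and the functor `C → C^birat` are CONSTRUCTED in
`Birationalization.lean` / `BirationalizationCategory.lean` (seat abc-iut-L6-t8: classes of birational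
fractions `(α, φ')`). This file (RULING C5‴, bridge (b)) proves that this construction IS the
localization of `C` at the class `W = coAngularPreSteps F` of co-angular pre-steps, in Mathlib's sense:

* `toBirat_inverts` — `C → C^birat` inverts every co-angular pre-step (the inverse of `α` is the class
  of `(α, id)`; [FrdI] Prop. 4.4 (iv) "co-angular pre-step ↦ isomorphism");
* `Birat.lift` / `toBirat_comp_lift` / `Birat.lift_unique` — the STRICT universal property: a functor
  `G : C → E` inverting `W` factors uniquely through `C → C^birat`, by `[(α, φ')] ↦ G(α)⁻¹ ∘ G(φ')`
  (well defined on the colimit since the transition maps are refinements by co-angular pre-steps);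
* `toBirat_isLocalization : (toBirat F hF hsq).IsLocalization (coAngularPreSteps F)`.

Consequently all of Mathlib's localization API (`Localization.lift`, 2-out-of-3, the calculus of
right fractions once `W.HasRightCalculusOfFractions` is known — `BiratLocalization.lean`) applies to
`C^birat`. Nothing here re-defines `C^birat`.
-/

namespace Literature.AlgebraicGeometry.Frobenioids

open CategoryTheory

namespace PreFrobenioid

universe w v v' u u' v₃ u₃

variable {D : Type u} [Category.{v} D] {Φ : Dᵒᵖ ⥤ CommMonCat.{w}}
  {C : Type u'} [Category.{v'} C] (F : C ⥤ ElemFrobenioid Φ)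

/-- `C^coa-pre`: the class of co-angular pre-steps of the pre-Frobenioid `C → F_Φ`, as a
`MorphismProperty` (the arrows inverted in `C^birat`, [FrdI] Prop. 4.4 (i) p. 82).
[cite: MochizukiFrdI2008, Prop. 4.4 (i) p.82] -/
def coAngularPreSteps : MorphismProperty C := fun _ _ f => IsCoAngularPreStep F f

variable {F}

/-- Membership in `C^coa-pre`. [cite: MochizukiFrdI2008, Prop. 4.4 (i) p.82] -/
@[simp] theorem coAngularPreSteps_iff {A B : C} (f : A ⟶ B) :
    coAngularPreSteps F f ↔ IsCoAngularPreStep F f := Iff.rfl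

/-- In a Frobenioid the co-angular pre-steps contain the identities and are stable under composition
(isomorphisms are co-angular pre-steps; Def. 1.3 (iii)(a)). [cite: MochizukiFrdI2008, Def. 1.3 (iii) p.24] -/
theorem coAngularPreSteps_isMultiplicative (hF : IsFrobenioid F) :
    (coAngularPreSteps F).IsMultiplicative where
  id_mem X := isCoAngularPreStep_id hF X
  comp_mem _ _ hf hg := hf.comp hF hg

variable {hF : IsFrobenioid F} {hsq : HasBiratSquares F}

/-! ### `C → C^birat` inverts the co-angular pre-steps -/

variable (hF hsq) in
/-- The inverse `α⁻¹ = [(α, id)] : A ⇢ A'` in `C^birat` of a co-angular pre-step `α : A' → A`.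
[cite: MochizukiFrdI2008, Prop. 4.4 (iv) p.83] -/
noncomputable def Birat.invOf {A' A : C} (α : A' ⟶ A) (hα : IsCoAngularPreStep F α) :
    (toBirat F hF hsq).obj A ⟶ (toBirat F hF hsq).obj A' :=
  Birat.homMk ⟨A', α, 𝟙 A', hα⟩

/-- `α ≫ α⁻¹ = id` in `C^birat`. [cite: MochizukiFrdI2008, Prop. 4.4 (iv) p.83] -/
theorem Birat.toBirat_map_comp_invOf {A' A : C} (α : A' ⟶ A) (hα : IsCoAngularPreStep F α) :
    (toBirat F hF hsq).map α ≫ Birat.invOf hF hsq α hα = 𝟙 _ :=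
  (toBirat_map_den_comp_homMk hF hsq ⟨A', α, 𝟙 A', hα⟩).trans ((toBirat F hF hsq).map_id _)

/-- `α⁻¹ ≫ α = id` in `C^birat`. [cite: MochizukiFrdI2008, Prop. 4.4 (iv) p.83] -/
theorem Birat.invOf_comp_toBirat_map {A' A : C} (α : A' ⟶ A) (hα : IsCoAngularPreStep F α) :
    Birat.invOf hF hsq α hα ≫ (toBirat F hF hsq).map α = 𝟙 _ := by
  let f : BiratFrac F A A' := ⟨A', α, 𝟙 A', hα⟩
  let S : BiratFrac.Square f (BiratFrac.ofHom hF α) :=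
    { apex := A', left := 𝟙 _, right := 𝟙 _, left_mem := isCoAngularPreStep_id hF _, w := rfl }
  refine (Birat.homMk_comp_homMk_eq (X := Birat.of F hF hsq A) (Y := Birat.of F hF hsq A')
    (Z := Birat.of F hF hsq A) f (BiratFrac.ofHom hF α) S).trans (Birat.homMk_sound ?_)
  refine ⟨A', 𝟙 _, α, isCoAngularPreStep_id hF _, hα, ?_, ?_⟩
  · change 𝟙 A' ≫ 𝟙 A' ≫ α = α ≫ 𝟙 A
    simp
  · change 𝟙 A' ≫ 𝟙 A' ≫ α = α ≫ 𝟙 A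
    simp

/-- **[FrdI] Prop. 4.4 (iv)**, "co-angular pre-step ↦ isomorphism": `C → C^birat` inverts the class
`W` of co-angular pre-steps. [cite: MochizukiFrdI2008, Prop. 4.4 (iv) p.83] -/
theorem toBirat_inverts (hF : IsFrobenioid F) (hsq : HasBiratSquares F) :
    (coAngularPreSteps F).IsInvertedBy (toBirat F hF hsq) :=
  fun _ _ α hα => ⟨Birat.invOf hF hsq α hα, Birat.toBirat_map_comp_invOf α hα,
    Birat.invOf_comp_toBirat_map α hα⟩

/-- Every birational morphism is `α⁻¹ ∘ φ'`: `[(α, φ')] = (toBirat α)⁻¹ ≫ toBirat φ'`.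
[cite: MochizukiFrdI2008, Prop. 4.4 (i) p.82] -/
theorem Birat.homMk_eq_inv_comp {A B : C} (f : BiratFrac F A B) :
    haveI := toBirat_inverts hF hsq f.den f.den_mem
    (Birat.homMk f : (toBirat F hF hsq).obj A ⟶ (toBirat F hF hsq).obj B) =
      inv ((toBirat F hF hsq).map f.den) ≫ (toBirat F hF hsq).map f.num := by
  haveI := toBirat_inverts hF hsq f.den f.den_mem
  exact (IsIso.eq_inv_comp _).mpr (toBirat_map_den_comp_homMk hF hsq f)

/-! ### The strict universal property -/

section lift

variable {E : Type u₃} [Category.{v₃} E] (G : C ⥤ E) (hG : (coAngularPreSteps F).IsInvertedBy G)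

/-- On a fraction `(α, φ')`: `G(α)⁻¹ ∘ G(φ')`. [cite: MochizukiFrdI2008, Prop. 4.4 (i) p.82] -/
noncomputable def Birat.liftMap {A B : C} (f : BiratFrac F A B) : G.obj A ⟶ G.obj B :=
  haveI := hG f.den f.den_mem
  inv (G.map f.den) ≫ G.map f.num

/-- Refining a fraction by an arrow that `G` inverts does not change `G(α)⁻¹ ∘ G(φ')`.
[cite: MochizukiFrdI2008, Prop. 4.4 (i) p.82] -/
theorem Birat.liftMap_restrict {A B X : C} (f : BiratFrac F A B) (ε : X ⟶ f.src)
    (hε : IsCoAngularPreStep F ε) :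
    Birat.liftMap G hG f =
      (haveI := hG _ (hε.comp hF f.den_mem); inv (G.map (ε ≫ f.den))) ≫ G.map (ε ≫ f.num) := by
  haveI := hG f.den f.den_mem
  haveI := hG ε hε
  haveI := hG _ (hε.comp hF f.den_mem)
  rw [Birat.liftMap, IsIso.eq_inv_comp, G.map_comp, G.map_comp, Category.assoc,
    IsIso.hom_inv_id_assoc]

/-- `G(α)⁻¹ ∘ G(φ')` is constant on colimit classes. [cite: MochizukiFrdI2008, Prop. 4.4 (i) p.82] -/
theorem Birat.liftMap_rel (hF : IsFrobenioid F) {A B : C} {f g : BiratFrac F A B}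
    (h : BiratFrac.Rel f g) : Birat.liftMap G hG f = Birat.liftMap G hG g := by
  obtain ⟨X, ε, ε', hε, hε', hden, hnum⟩ := h
  rw [Birat.liftMap_restrict (hF := hF) G hG f ε hε, Birat.liftMap_restrict (hF := hF) G hG g ε' hε']
  simp only [hden, hnum]

variable (hF hsq) in
/-- **The functor `C^birat → E` induced by a functor `G : C → E` inverting the co-angular pre-steps**
(universal property of [FrdI] Prop. 4.4 (i)): identity on objects, `[(α, φ')] ↦ G(α)⁻¹ ∘ G(φ')`.
[cite: MochizukiFrdI2008, Prop. 4.4 (i) p.82] -/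
noncomputable def Birat.lift : Birat F hF hsq ⥤ E where
  obj X := G.obj X.out
  map {X Y} g := Quotient.lift (Birat.liftMap G hG) (fun _ _ h => Birat.liftMap_rel G hG hF h) g
  map_id X := by
    change Birat.liftMap G hG (BiratFrac.ofHom hF (𝟙 X.out)) = _
    simp [Birat.liftMap, BiratFrac.ofHom]
  map_comp {X Y Z} g g' := by
    obtain ⟨f, rfl⟩ := Birat.homMk_surjective g
    obtain ⟨f', rfl⟩ := Birat.homMk_surjective g'
    let S := BiratFrac.someSquare hsq f f'
    rw [Birat.homMk_comp_homMk_eq f f' S]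
    change Birat.liftMap G hG (BiratFrac.compWith hF f f' S) =
      Birat.liftMap G hG f ≫ Birat.liftMap G hG f'
    haveI := hG f.den f.den_mem
    haveI := hG f'.den f'.den_mem
    haveI := hG S.left S.left_mem
    haveI := hG _ (S.left_mem.comp hF f.den_mem)
    simp only [Birat.liftMap, BiratFrac.compWith]
    apply (IsIso.inv_comp_eq _).mpr
    simp only [G.map_comp, Category.assoc, IsIso.hom_inv_id_assoc]
    rw [← G.map_comp_assoc, S.w, G.map_comp_assoc, IsIso.hom_inv_id_assoc, ← G.map_comp]

/-- The lift on a class of fractions. [cite: MochizukiFrdI2008, Prop. 4.4 (i) p.82] -/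
theorem Birat.lift_map_homMk {X Y : Birat F hF hsq} (f : BiratFrac F X.out Y.out) :
    (Birat.lift hF hsq G hG).map (Birat.homMk f) = Birat.liftMap G hG f := rfl

/-- **Factorisation**: `(C → C^birat) ⋙ lift G = G`. [cite: MochizukiFrdI2008, Prop. 4.4 (i) p.82] -/
theorem toBirat_comp_lift : toBirat F hF hsq ⋙ Birat.lift hF hsq G hG = G := by
  refine CategoryTheory.Functor.hext (fun _ => rfl) (fun A B φ => heq_of_eq ?_)
  change Birat.liftMap G hG (BiratFrac.ofHom hF φ) = G.map φ
  simp [Birat.liftMap, BiratFrac.ofHom]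

end lift

/-- **Canonical form** of a functor out of `C^birat`: it is the lift of its restriction to `C` (every
birational morphism being `α⁻¹ ∘ φ'`). [cite: MochizukiFrdI2008, Prop. 4.4 (i) p.82] -/
theorem Birat.eq_lift {E : Type u₃} [Category.{v₃} E] (H : Birat F hF hsq ⥤ E) :
    H = Birat.lift hF hsq (toBirat F hF hsq ⋙ H)
      (fun _ _ α hα => by haveI := toBirat_inverts hF hsq α hα; exact Functor.map_isIso H _) := by
  refine CategoryTheory.Functor.hext (fun _ => rfl) (fun X Y g => ?_)
  obtain ⟨f, rfl⟩ := Birat.homMk_surjective g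
  apply heq_of_eq
  haveI := toBirat_inverts hF hsq f.den f.den_mem
  change H.map (Birat.homMk f : (toBirat F hF hsq).obj X.out ⟶ (toBirat F hF hsq).obj Y.out) =
    inv (H.map ((toBirat F hF hsq).map f.den)) ≫ H.map ((toBirat F hF hsq).map f.num)
  rw [Birat.homMk_eq_inv_comp, H.map_comp, H.map_inv]

/-- **Uniqueness**: two functors out of `C^birat` that agree on `C` are equal.
[cite: MochizukiFrdI2008, Prop. 4.4 (i) p.82] -/
theorem Birat.lift_unique {E : Type u₃} [Category.{v₃} E] (H₁ H₂ : Birat F hF hsq ⥤ E)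
    (h : toBirat F hF hsq ⋙ H₁ = toBirat F hF hsq ⋙ H₂) : H₁ = H₂ := by
  rw [Birat.eq_lift H₁, Birat.eq_lift H₂]
  have key : ∀ (G G' : C ⥤ E) (e : G = G') (hG : (coAngularPreSteps F).IsInvertedBy G)
      (hG' : (coAngularPreSteps F).IsInvertedBy G'),
      Birat.lift hF hsq G hG = Birat.lift hF hsq G' hG' := by
    rintro G _ rfl _ _; rfl
  exact key _ _ h _ _

variable (hF hsq) in
/-- The strict universal property of `C → C^birat` for a fixed target (Mathlib packaging).
[cite: MochizukiFrdI2008, Prop. 4.4 (i) p.82] -/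
noncomputable def Birat.strictUniversalPropertyFixedTarget (E : Type u₃) [Category.{v₃} E] :
    Localization.StrictUniversalPropertyFixedTarget (toBirat F hF hsq) (coAngularPreSteps F) E where
  inverts := toBirat_inverts hF hsq
  lift G hG := Birat.lift hF hsq G hG
  fac G hG := toBirat_comp_lift G hG
  uniq H₁ H₂ h := Birat.lift_unique H₁ H₂ h

/-- **`C → C^birat` is a localization of `C` at the co-angular pre-steps** ([FrdI] Prop. 4.4 (i) in
Mathlib's language). [cite: MochizukiFrdI2008, Prop. 4.4 (i) p.82] -/
theorem toBirat_isLocalization (hF : IsFrobenioid F) (hsq : HasBiratSquares F) :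
    (toBirat F hF hsq).IsLocalization (coAngularPreSteps F) :=
  Functor.IsLocalization.mk' _ _ (Birat.strictUniversalPropertyFixedTarget hF hsq _)
    (Birat.strictUniversalPropertyFixedTarget hF hsq _)

end PreFrobenioid

end Literature.AlgebraicGeometry.Frobenioids
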